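import Literature.NumberTheory.GaloisRepresentations.PowerSeriesTopNilpotentAction
import HarnessLib

/-!
# A triangular-basis criterion for the `S⟦T⟧`-action `c(T)·r = Σ c_k D^k r` on `S⟦Y⟧`, part 1:
# if `D(Y^k) ≡ Y^{k+d} (mod p, Y^{k+d+1})` for all `k`, the triangular system `D^{⌊n/d⌋}Y^{n mod d}` and surjectivity of
# `(c_j)_{j<d} ↦ Σ_{j<d} c_j(T)·Y^j` MODULO `p` (de Shalit I §3.1 "`Λ(𝒢) ≅ ℤ_p[Δ]⟦S⟧`", Washington §13.2)

De Shalit, *Iwasawa theory of elliptic curves with complex multiplication* (1987), Ch. I §3.1: the completed group ring of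
`𝒢 ≅ ℤ_p^×` is `ℤ_p[Δ]⟦S⟧`, free of finite rank over `Λ(Γ') = ℤ_p⟦S⟧`; Theorem I.3.7 makes the norm-coherent units a
`Λ(𝒢)`-module through the coordinates `r_β ∈ 𝒪⟦Y⟧`.  In the tree's series currency the `𝒪⟦T⟧`-module structure on
`S⟦Y⟧` is the action `tAct D` (`PowerSeriesTopNilpotentAction`) of a topologically nilpotent `S`-linear `D` (`D(I_N) ⊆ I_{N+1}`
for the `(p, Y)`-adic filtration `I_N = adicFiltGen p N`).  This file proves the FREENESS half abstractly:

* `degFilt p m` — the ideal `J_m = (p) + (Y^m)` coefficientwise (`coeff_i ∈ (p)` for `i < m`); `adicFiltGen_le_degFilt`;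
* under **`hT : D(Y^k) − Y^{k+d} ∈ J_{k+d+1}`** (all `k`): `apply_mem_degFilt_add` (`D J_m ⊆ J_{m+d}`), the triangular system
  `triBasis n = D^{⌊n/d⌋} Y^{n mod d} ≡ Y^n (mod J_{n+1})` (`triBasis_sub_X_pow_mem`);
* `basisMap c = Σ_{j<d} c_j(T)·Y^j`, its additivity / `S`-linearity / continuity (`basisMap_mem_adicFiltGen`), and ★
  `basisMap_sub_sum_mem` (`Σ_j c_j·Y^j ≡ Σ_{n<dK} [T^{⌊n/d⌋}]c_{n mod d} · triBasis n (mod J_K)`);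
* ★★ `exists_basisMap_add_C_mul` — **surjectivity modulo `p`**: every `V ∈ S⟦Y⟧` is `Σ_{j<d} c_j·Y^j + p·W` (triangular
  solution `approxRem`).  The sequel `PowerSeriesTopNilpotentBasisFree` lifts this to freeness of rank `d` (existence by `p`-adic
  refinement, uniqueness) and records the rank-two case met by the Coleman coordinates at `q = 2`.

Everything PROVED (0 sorry, no named facts); transparent definitions `degFilt`, `triBasis`, `approxRem`, `basisMap`.

## References

* E. de Shalit, *Iwasawa theory of elliptic curves with complex multiplication* (1987), Ch. I §3.1, §3.7. [deShalit1987]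
* L. C. Washington, *Introduction to Cyclotomic Fields*, 2nd ed. (1997), §7.1, §13.2. [Washington1997]
-/

noncomputable section

namespace Literature.NumberTheory.GaloisRepresentations

namespace LubinTate

section TopNilpotentBasis

open Finset

variable {S : Type*} [CommRing S] {p : S}

/-! ### The filtration `J_m = (p) + (Y^m)` -/

/-- `J_m = {V : coeff_i V ∈ (p) for all i < m}`, the ideal `(p, Y^m)` coefficientwise. [cite: deShalit1987, Ch. I §3.1] -/
def degFilt (p : S) (m : ℕ) : Ideal (PowerSeries S) where
  carrier := {V | ∀ i, i < m → PowerSeries.coeff i V ∈ Ideal.span {p}}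
  add_mem' {a b} ha hb i hi := by rw [map_add]; exact add_mem (ha i hi) (hb i hi)
  zero_mem' i _ := by rw [map_zero]; exact zero_mem _
  smul_mem' c V hV i hi := by
    rw [smul_eq_mul, PowerSeries.coeff_mul]
    refine Ideal.sum_mem _ fun x hx => ?_
    have hx' := mem_antidiagonal.mp hx
    exact Ideal.mul_mem_left _ _ (hV x.2 (by omega))

/-- Membership in `J_m` (unfolding). [cite: deShalit1987, Ch. I §3.1] -/
theorem mem_degFilt_iff {m : ℕ} {V : PowerSeries S} :
    V ∈ degFilt p m ↔ ∀ i, i < m → PowerSeries.coeff i V ∈ Ideal.span {p} := Iff.rfl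

/-- `J_a ⊆ J_b` for `b ≤ a`. [cite: deShalit1987, Ch. I §3.1] -/
theorem degFilt_mono {a b : ℕ} (hab : b ≤ a) : degFilt p a ≤ degFilt p b := fun _ hV i hi => hV i (lt_of_lt_of_le hi hab)

/-- `J_0 = S⟦Y⟧`. [cite: deShalit1987, Ch. I §3.1] -/
theorem mem_degFilt_zero (V : PowerSeries S) : V ∈ degFilt p 0 := fun i hi => absurd hi (Nat.not_lt_zero i)

/-- `I_N ⊆ J_N` (`I_N = adicFiltGen p N` the `(p, Y)`-adic filtration). [cite: deShalit1987, Ch. I §3.1] -/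
theorem adicFiltGen_le_degFilt (N : ℕ) : adicFiltGen p N ≤ degFilt p N := fun _ hV i hi =>
  Ideal.mem_span_singleton.mpr (dvd_trans (dvd_pow_self p (by omega)) (Ideal.mem_span_singleton.mp (hV i)))

/-- A series with all coefficients in `(p)` lies in every `J_m`. [cite: deShalit1987, Ch. I §3.1] -/
theorem mem_degFilt_of_forall_coeff_mem {V : PowerSeries S} (h : ∀ i, PowerSeries.coeff i V ∈ Ideal.span {p}) (m : ℕ) :
    V ∈ degFilt p m := fun i _ => h i

/-- `⋂_m J_m = p·S⟦Y⟧` (coefficientwise). [cite: deShalit1987, Ch. I §3.1] -/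
theorem forall_mem_degFilt_iff {V : PowerSeries S} : (∀ m, V ∈ degFilt p m) ↔ ∀ i, PowerSeries.coeff i V ∈ Ideal.span {p} :=
  ⟨fun h i => h (i + 1) i (Nat.lt_succ_self i), fun h m => mem_degFilt_of_forall_coeff_mem h m⟩

/-- `a·V ∈ J_m` for `a ∈ (p)`. [cite: deShalit1987, Ch. I §3.1] -/
theorem C_mul_mem_degFilt {a : S} (ha : a ∈ Ideal.span {p}) (V : PowerSeries S) (m : ℕ) : PowerSeries.C a * V ∈ degFilt p m :=
  fun i _ => by rw [PowerSeries.coeff_C_mul]; exact Ideal.mul_mem_right _ _ ha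

/-- `Y^n ∈ J_m` for `m ≤ n`. [cite: deShalit1987, Ch. I §3.1] -/
theorem X_pow_mem_degFilt {m n : ℕ} (h : m ≤ n) : (PowerSeries.X : PowerSeries S) ^ n ∈ degFilt p m := fun i hi => by
  rw [PowerSeries.coeff_X_pow, if_neg (by omega)]; exact zero_mem _

/-- `Y^M · W ∈ I_M`. [cite: deShalit1987, Ch. I §3.1] -/
theorem X_pow_mul_mem_adicFiltGen (M : ℕ) (W : PowerSeries S) : PowerSeries.X ^ M * W ∈ adicFiltGen p M := fun k => by
  rw [PowerSeries.coeff_X_pow_mul']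
  split_ifs with h
  · rw [show M - k = 0 by omega, pow_zero, Ideal.span_singleton_one]; exact Submodule.mem_top
  · exact zero_mem _

/-- `V = Σ_{i<M} V_i Y^i + Y^M · W`. [cite: Washington1997, §7.1] -/
theorem exists_eq_sum_add_X_pow_mul (V : PowerSeries S) (M : ℕ) :
    ∃ W : PowerSeries S, V = (∑ i ∈ range M, PowerSeries.C (PowerSeries.coeff i V) * PowerSeries.X ^ i) + PowerSeries.X ^ M * W := by
  have h : (PowerSeries.X : PowerSeries S) ^ M ∣ V - ∑ i ∈ range M, PowerSeries.C (PowerSeries.coeff i V) * PowerSeries.X ^ i := by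
    rw [PowerSeries.X_pow_dvd_iff]
    intro m hm
    rw [map_sub, map_sum]
    simp_rw [PowerSeries.coeff_C_mul_X_pow]
    rw [sum_ite_eq (range M), if_pos (mem_range.mpr hm), sub_self]
  obtain ⟨W, hW⟩ := h
  exact ⟨W, by rw [← hW]; ring⟩

/-! ### Triangularity: `D(Y^k) ≡ Y^{k+d}` -/

variable {D : PowerSeries S →ₗ[S] PowerSeries S}
  (hD : ∀ N (r : PowerSeries S), r ∈ adicFiltGen p N → D r ∈ adicFiltGen p (N + 1))
  {d : ℕ} (hT : ∀ k : ℕ, D (PowerSeries.X ^ k) - PowerSeries.X ^ (k + d) ∈ degFilt p (k + d + 1))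

include hD hT in
/-- ★ **`D(J_m) ⊆ J_{m+d}`** (from `D(Y^i) ∈ J_{i+d}` for the finitely many `m ≤ i < m + d`, `D(p·) ⊆ p·`, and `D(Y^{m+d}·W) ∈ I_{m+d+1}`).
[cite: deShalit1987, Ch. I §3.1] -/
theorem apply_mem_degFilt_add {m : ℕ} {V : PowerSeries S} (hV : V ∈ degFilt p m) : D V ∈ degFilt p (m + d) := by
  obtain ⟨W, hW⟩ := exists_eq_sum_add_X_pow_mul V (m + d)
  rw [hW, map_add, map_sum]
  refine add_mem (Ideal.sum_mem _ fun i _ => ?_) ?_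
  · rw [← PowerSeries.smul_eq_C_mul, map_smul, PowerSeries.smul_eq_C_mul]
    rcases lt_or_ge i m with him | him
    · exact C_mul_mem_degFilt (hV i him) _ _
    · have e : D (PowerSeries.X ^ i) = (D (PowerSeries.X ^ i) - PowerSeries.X ^ (i + d)) + PowerSeries.X ^ (i + d) := by ring
      rw [e]
      exact Ideal.mul_mem_left _ _ (add_mem (degFilt_mono (by omega) (hT i)) (X_pow_mem_degFilt (by omega)))
  · exact degFilt_mono (by omega) (adicFiltGen_le_degFilt _ (hD _ _ (X_pow_mul_mem_adicFiltGen (m + d) W)))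

include hD hT in
/-- `V ≡ Y^n (mod J_{n+1}) ⟹ D V ≡ Y^{n+d} (mod J_{n+d+1})`. [cite: deShalit1987, Ch. I §3.1] -/
theorem apply_sub_X_pow_mem_degFilt {n : ℕ} {V : PowerSeries S} (hV : V - PowerSeries.X ^ n ∈ degFilt p (n + 1)) :
    D V - PowerSeries.X ^ (n + d) ∈ degFilt p (n + d + 1) := by
  have e : D V - PowerSeries.X ^ (n + d) = D (V - PowerSeries.X ^ n) + (D (PowerSeries.X ^ n) - PowerSeries.X ^ (n + d)) := by
    rw [map_sub]; ring
  rw [e]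
  refine add_mem ?_ (hT n)
  have h := apply_mem_degFilt_add hD hT hV
  rwa [show n + 1 + d = n + d + 1 by ring] at h

include hD hT in
/-- `D^k(Y^j) ≡ Y^{j+kd} (mod J_{j+kd+1})`. [cite: deShalit1987, Ch. I §3.1] -/
theorem iterate_X_pow_sub_mem_degFilt (j k : ℕ) :
    (⇑D)^[k] (PowerSeries.X ^ j) - PowerSeries.X ^ (j + k * d) ∈ degFilt p (j + k * d + 1) := by
  induction k with
  | zero => simp only [Function.iterate_zero_apply, Nat.zero_mul, Nat.add_zero, sub_self]; exact zero_mem _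
  | succ k ih =>
    rw [Function.iterate_succ_apply']
    have h := apply_sub_X_pow_mem_degFilt hD hT ih
    rwa [show j + k * d + d = j + (k + 1) * d by ring] at h

variable (D d) in
/-- The triangular system **`triBasis n = D^{⌊n/d⌋} (Y^{n mod d})`** (one element of leading degree `n` for every `n`).
[cite: deShalit1987, Ch. I §3.1] -/
def triBasis (n : ℕ) : PowerSeries S := (⇑D)^[n / d] (PowerSeries.X ^ (n % d))

/-- Unfolding `triBasis`. [cite: deShalit1987, Ch. I §3.1] -/
theorem triBasis_def (n : ℕ) : triBasis D d n = (⇑D)^[n / d] (PowerSeries.X ^ (n % d)) := rfl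

/-- `triBasis (j + kd) = D^k (Y^j)` for `j < d`. [cite: deShalit1987, Ch. I §3.1] -/
theorem triBasis_add_mul {j : ℕ} (hj : j < d) (k : ℕ) : triBasis D d (j + k * d) = (⇑D)^[k] (PowerSeries.X ^ j) := by
  have hd : 0 < d := by omega
  rw [triBasis_def, Nat.add_mul_div_right j k hd, Nat.div_eq_of_lt hj, Nat.zero_add, Nat.add_mul_mod_self_right, Nat.mod_eq_of_lt hj]

include hD hT in
/-- ★ **`triBasis n ≡ Y^n (mod J_{n+1})`**. [cite: deShalit1987, Ch. I §3.1] -/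
theorem triBasis_sub_X_pow_mem (n : ℕ) : triBasis D d n - PowerSeries.X ^ n ∈ degFilt p (n + 1) := by
  have h := iterate_X_pow_sub_mem_degFilt hD hT (n % d) (n / d)
  rwa [show n % d + n / d * d = n by rw [Nat.mul_comm]; exact Nat.mod_add_div n d] at h

include hD hT in
/-- The coefficients of `triBasis n` below degree `n` lie in `(p)`. [cite: deShalit1987, Ch. I §3.1] -/
theorem coeff_triBasis_mem_of_lt {n i : ℕ} (hi : i < n) : PowerSeries.coeff i (triBasis D d n) ∈ Ideal.span {p} := by
  have h := triBasis_sub_X_pow_mem hD hT n i (by omega)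
  rwa [map_sub, PowerSeries.coeff_X_pow, if_neg (by omega), sub_zero] at h

include hD hT in
/-- The leading coefficient of `triBasis n` is `≡ 1 (mod p)`. [cite: deShalit1987, Ch. I §3.1] -/
theorem coeff_triBasis_self_sub_one_mem (n : ℕ) : PowerSeries.coeff n (triBasis D d n) - 1 ∈ Ideal.span {p} := by
  have h := triBasis_sub_X_pow_mem hD hT n n (by omega)
  rwa [map_sub, PowerSeries.coeff_X_pow, if_pos rfl] at h

/-! ### Triangular solution modulo `p` -/

variable (D d) in
/-- Remainders of the triangular elimination: `R_0 = V`, `R_{N+1} = R_N − [Y^N]R_N · triBasis N`. [cite: deShalit1987, Ch. I §3.1] -/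
def approxRem (V : PowerSeries S) : ℕ → PowerSeries S
  | 0 => V
  | N + 1 => approxRem V N - PowerSeries.C (PowerSeries.coeff N (approxRem V N)) * triBasis D d N

/-- `R_{N+1} = R_N − [Y^N]R_N · triBasis N` (unfolding). [cite: deShalit1987, Ch. I §3.1] -/
theorem approxRem_succ (V : PowerSeries S) (N : ℕ) :
    approxRem D d V (N + 1) = approxRem D d V N - PowerSeries.C (PowerSeries.coeff N (approxRem D d V N)) * triBasis D d N := rfl

/-- `R_N = V − Σ_{n<N} [Y^n]R_n · triBasis n`. [cite: deShalit1987, Ch. I §3.1] -/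
theorem approxRem_eq (V : PowerSeries S) (N : ℕ) :
    approxRem D d V N = V - ∑ n ∈ range N, PowerSeries.C (PowerSeries.coeff n (approxRem D d V n)) * triBasis D d n := by
  induction N with
  | zero => rw [sum_range_zero, sub_zero]; rfl
  | succ N ih => rw [approxRem_succ, sum_range_succ, ih, ← sub_sub, ← ih]

include hD hT in
/-- ★ `R_N ∈ J_N`: the elimination kills one coefficient modulo `p` at a time. [cite: deShalit1987, Ch. I §3.1] -/
theorem approxRem_mem_degFilt (V : PowerSeries S) : ∀ N, approxRem D d V N ∈ degFilt p N := by
  intro N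
  induction N with
  | zero => exact mem_degFilt_zero _
  | succ N ih =>
    intro i hi
    rw [approxRem_succ, map_sub, PowerSeries.coeff_C_mul]
    rcases Nat.lt_succ_iff_lt_or_eq.mp hi with hi | rfl
    · exact sub_mem (ih i hi) (Ideal.mul_mem_left _ _ (coeff_triBasis_mem_of_lt hD hT hi))
    · have e : PowerSeries.coeff i (approxRem D d V i) - PowerSeries.coeff i (approxRem D d V i) * PowerSeries.coeff i (triBasis D d i) =
          -(PowerSeries.coeff i (approxRem D d V i) * (PowerSeries.coeff i (triBasis D d i) - 1)) := by ring
      rw [e]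
      exact neg_mem (Ideal.mul_mem_left _ _ (coeff_triBasis_self_sub_one_mem hD hT i))

include hD hT in
/-- ★ **Triangular solution modulo `p`**: with `s_n = [Y^n]R_n`, `V ≡ Σ_{n<N} s_n · triBasis n (mod J_N)` for every `N`.
[cite: deShalit1987, Ch. I §3.1] -/
theorem sub_sum_approx_mem_degFilt (V : PowerSeries S) (N : ℕ) :
    V - ∑ n ∈ range N, PowerSeries.C (PowerSeries.coeff n (approxRem D d V n)) * triBasis D d n ∈ degFilt p N := by
  rw [← approxRem_eq]; exact approxRem_mem_degFilt hD hT V N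

/-! ### The candidate basis map `c ↦ Σ_{j<d} c_j(T)·Y^j` -/

variable (D d) in
/-- **`basisMap c = Σ_{j<d} c_j(T)·Y^j`** for `c : ℕ → S⟦T⟧` (only `c_0, …, c_{d−1}` matter). [cite: deShalit1987, Ch. I §3.1] -/
def basisMap [IsPrecomplete (Ideal.span {p}) S] (c : ℕ → PowerSeries S) : PowerSeries S :=
  ∑ j ∈ range d, tAct D hD (c j) (PowerSeries.X ^ j)

/-- Unfolding `basisMap`. [cite: deShalit1987, Ch. I §3.1] -/
theorem basisMap_def [IsPrecomplete (Ideal.span {p}) S] (c : ℕ → PowerSeries S) :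
    basisMap D hD d c = ∑ j ∈ range d, tAct D hD (c j) (PowerSeries.X ^ j) := rfl

variable [IsAdicComplete (Ideal.span {p}) S]

/-- `(c − c′)·r = c·r − c′·r`. [cite: Washington1997, §13.2] -/
theorem tAct_sub_left (c c' r : PowerSeries S) : tAct D hD (c - c') r = tAct D hD c r - tAct D hD c' r :=
  eq_sub_of_add_eq (by rw [← tAct_add_left, sub_add_cancel])

/-- `0·r = 0`. [cite: Washington1997, §13.2] -/
theorem tAct_zero_left (r : PowerSeries S) : tAct D hD 0 r = 0 := by
  rw [← map_zero PowerSeries.C, tAct_C, map_zero, zero_mul]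

/-- **`c ∈ I_n ⟹ c·r ∈ I_n`** (continuity of the action in the `S⟦T⟧`-variable). [cite: Washington1997, §13.2] -/
theorem tAct_mem_adicFiltGen_left {n : ℕ} {c : PowerSeries S} (hc : c ∈ adicFiltGen p n) (r : PowerSeries S) :
    tAct D hD c r ∈ adicFiltGen p n := by
  have h1 := tAct_sub_tPartial_mem hD c r n
  have h2 : tPartial D c r n ∈ adicFiltGen p n := by
    rw [tPartial_def]
    refine Ideal.sum_mem _ fun k hk => ?_
    have hk' := mem_range.mp hk
    have h := mul_mem_adicFiltGen (C_mem_adicFiltGen (hc k)) (iterate_mem_adicFiltGen hD k (mem_adicFiltGen_zero (p := p) r))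
    rwa [Nat.zero_add, Nat.sub_add_cancel hk'.le] at h
  have h := add_mem h1 h2
  rwa [sub_add_cancel] at h

/-- `basisMap` is additive. [cite: deShalit1987, Ch. I §3.1] -/
theorem basisMap_add (c c' : ℕ → PowerSeries S) : basisMap D hD d (c + c') = basisMap D hD d c + basisMap D hD d c' := by
  rw [basisMap_def, basisMap_def, basisMap_def, ← sum_add_distrib]
  exact sum_congr rfl fun j _ => by rw [Pi.add_apply, tAct_add_left]

/-- `basisMap` is compatible with subtraction. [cite: deShalit1987, Ch. I §3.1] -/
theorem basisMap_sub (c c' : ℕ → PowerSeries S) : basisMap D hD d (c - c') = basisMap D hD d c - basisMap D hD d c' := by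
  rw [basisMap_def, basisMap_def, basisMap_def, ← sum_sub_distrib]
  exact sum_congr rfl fun j _ => by rw [Pi.sub_apply, tAct_sub_left]

/-- `basisMap` is `S`-linear: `Σ (a c_j)·Y^j = a · Σ c_j·Y^j`. [cite: deShalit1987, Ch. I §3.1] -/
theorem basisMap_C_mul (a : S) (c : ℕ → PowerSeries S) :
    basisMap D hD d (fun j => PowerSeries.C a * c j) = PowerSeries.C a * basisMap D hD d c := by
  rw [basisMap_def, basisMap_def, mul_sum]
  exact sum_congr rfl fun j _ => by rw [tAct_C_mul_left]

/-- `basisMap 0 = 0`. [cite: deShalit1987, Ch. I §3.1] -/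
theorem basisMap_zero : basisMap D hD d (fun _ => 0) = 0 := by
  rw [basisMap_def]; exact sum_eq_zero fun j _ => tAct_zero_left hD _

/-- `c_j ∈ I_n (j < d) ⟹ basisMap c ∈ I_n`. [cite: deShalit1987, Ch. I §3.1] -/
theorem basisMap_mem_adicFiltGen {n : ℕ} {c : ℕ → PowerSeries S} (hc : ∀ j, j < d → c j ∈ adicFiltGen p n) :
    basisMap D hD d c ∈ adicFiltGen p n := by
  rw [basisMap_def]; exact Ideal.sum_mem _ fun j hj => tAct_mem_adicFiltGen_left hD (hc j (mem_range.mp hj)) _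

/-- ★ **`Σ_{j<d} c_j·Y^j ≡ Σ_{n<dK} [T^{⌊n/d⌋}]c_{n mod d} · triBasis n (mod J_K)`** — the action in the triangular system.
[cite: deShalit1987, Ch. I §3.1] -/
theorem basisMap_sub_sum_mem (hd : 0 < d) (c : ℕ → PowerSeries S) (K : ℕ) :
    basisMap D hD d c - ∑ n ∈ range (d * K), PowerSeries.C (PowerSeries.coeff (n / d) (c (n % d))) * triBasis D d n ∈ degFilt p K := by
  have e : ∑ n ∈ range (d * K), PowerSeries.C (PowerSeries.coeff (n / d) (c (n % d))) * triBasis D d n =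
      ∑ j ∈ range d, tPartial D (c j) (PowerSeries.X ^ j) K := by
    have e1 : ∀ K', ∑ n ∈ range (d * K'), PowerSeries.C (PowerSeries.coeff (n / d) (c (n % d))) * triBasis D d n =
        ∑ k ∈ range K', ∑ j ∈ range d, PowerSeries.C (PowerSeries.coeff k (c j)) * (⇑D)^[k] (PowerSeries.X ^ j) := by
      intro K'
      induction K' with
      | zero => rw [Nat.mul_zero, sum_range_zero, sum_range_zero]
      | succ K' ih =>
        rw [Nat.mul_succ, sum_range_add, ih, sum_range_succ]
        congr 1
        refine sum_congr rfl fun j hj => ?_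
        have hj' := mem_range.mp hj
        rw [show d * K' + j = j + K' * d by ring, triBasis_add_mul hj', Nat.add_mul_div_right j K' hd, Nat.div_eq_of_lt hj',
          Nat.zero_add, Nat.add_mul_mod_self_right, Nat.mod_eq_of_lt hj']
    rw [e1, sum_comm]
    exact sum_congr rfl fun j _ => by rw [tPartial_def]
  rw [e, basisMap_def, ← sum_sub_distrib]
  exact Ideal.sum_mem _ fun j _ => adicFiltGen_le_degFilt K (tAct_sub_tPartial_mem hD (c j) _ K)

/-! ### Existence: every `V` is `Σ_{j<d} c_j·Y^j` -/

include hT in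
/-- ★ **Surjectivity modulo `p`**: for every `V` there is `c` with `V ≡ Σ_{j<d} c_j·Y^j (mod p)` (all coefficients of the
difference in `(p)`): `c_j = Σ_k s_{j+kd} T^k` with the triangular solution `s`. [cite: deShalit1987, Ch. I §3.1] -/
theorem exists_basisMap_add_C_mul (hd : 0 < d) (V : PowerSeries S) :
    ∃ (c : ℕ → PowerSeries S) (W : PowerSeries S), V = basisMap D hD d c + PowerSeries.C p * W := by
  set c : ℕ → PowerSeries S := fun j => PowerSeries.mk fun k => PowerSeries.coeff (j + k * d) (approxRem D d V (j + k * d)) with hc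
  have hmem : ∀ i, PowerSeries.coeff i (V - basisMap D hD d c) ∈ Ideal.span {p} := by
    refine forall_mem_degFilt_iff.mp fun K => ?_
    have h1 := basisMap_sub_sum_mem hD hd c K
    have h2 := sub_sum_approx_mem_degFilt hD hT V (d * K)
    have e : ∑ n ∈ range (d * K), PowerSeries.C (PowerSeries.coeff (n / d) (c (n % d))) * triBasis D d n =
        ∑ n ∈ range (d * K), PowerSeries.C (PowerSeries.coeff n (approxRem D d V n)) * triBasis D d n := by
      refine sum_congr rfl fun n _ => ?_
      rw [hc, PowerSeries.coeff_mk, show n % d + n / d * d = n by rw [Nat.mul_comm]; exact Nat.mod_add_div n d]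
    rw [e] at h1
    have h := sub_mem (degFilt_mono (Nat.le_mul_of_pos_left K hd) h2) h1
    rwa [sub_sub_sub_cancel_right] at h
  have hw : ∀ i, ∃ w : S, PowerSeries.coeff i (V - basisMap D hD d c) = p * w := fun i => by
    obtain ⟨w, hw⟩ := Ideal.mem_span_singleton'.mp (hmem i)
    exact ⟨w, by rw [← hw, mul_comm]⟩
  choose w hw using hw
  refine ⟨c, PowerSeries.mk w, ?_⟩
  rw [← sub_eq_iff_eq_add']
  ext i
  rw [hw i, PowerSeries.coeff_C_mul, PowerSeries.coeff_mk]

end TopNilpotentBasis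

end LubinTate

end Literature.NumberTheory.GaloisRepresentations
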